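import Mathlib
import Summits.Ventures.PercRepro2.K5HyperK3

/-!
# THE HYPEREDGE BASE TERMS OF THE CRUX KERNEL `K₃` ON `K₅`, PART `T(1)`, A
(blind cell PercRepro2, typer-1 g10; mine-1 §23.12; twin `k5hyper_k3_typer.py`)

One `decide +kernel` per triangle `T` and type: `N(K₅ + T(1)) ≥ 0` / `N(K₅ + T(2)) ≥ 0` at every `K₅` profile
(`CertLE (sumT1 negOn3 D) (sumT1 posOn3 D)`, the (TRI) count being `pos − neg`).
-/

namespace Summit.Ventures.PercRepro2

namespace K5

set_option maxRecDepth 100000 in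
/-- `N(K₅ + T(1)) ≥ 0` for `T = {0, 1, 2}`. -/
theorem cert_K3T1_012 : CertLE (sumT1 negOn3 (triMask 0 1 2)) (sumT1 posOn3 (triMask 0 1 2)) := by
  unfold CertLE
  decide +kernel

set_option maxRecDepth 100000 in
/-- `N(K₅ + T(1)) ≥ 0` for `T = {0, 1, 3}`. -/
theorem cert_K3T1_013 : CertLE (sumT1 negOn3 (triMask 0 1 3)) (sumT1 posOn3 (triMask 0 1 3)) := by
  unfold CertLE
  decide +kernel

set_option maxRecDepth 100000 in
/-- `N(K₅ + T(1)) ≥ 0` for `T = {0, 1, 4}`. -/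
theorem cert_K3T1_014 : CertLE (sumT1 negOn3 (triMask 0 1 4)) (sumT1 posOn3 (triMask 0 1 4)) := by
  unfold CertLE
  decide +kernel

set_option maxRecDepth 100000 in
/-- `N(K₅ + T(1)) ≥ 0` for `T = {0, 2, 3}`. -/
theorem cert_K3T1_023 : CertLE (sumT1 negOn3 (triMask 0 2 3)) (sumT1 posOn3 (triMask 0 2 3)) := by
  unfold CertLE
  decide +kernel

set_option maxRecDepth 100000 in
/-- `N(K₅ + T(1)) ≥ 0` for `T = {0, 2, 4}`. -/
theorem cert_K3T1_024 : CertLE (sumT1 negOn3 (triMask 0 2 4)) (sumT1 posOn3 (triMask 0 2 4)) := by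
  unfold CertLE
  decide +kernel

end K5

end Summit.Ventures.PercRepro2
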